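import Summits.Langlands.Langlands.Theorems.RationalPeriodQuarterAnalyticCoreCharts

/-!
# `AnalyticCore` (child 2 of the lens-1-g38 split of `RationalPeriodQuarter.SemiAnalyticRigidity`) — rigidity at infinity

THE STEP AT `∞`.  Input (coordinate `u = (N t + 1)⁻¹`, `τ u = (1 - u)/(N u)`): `h (τ u) = u·G u + wpl u` for small
`u > 0` and `h (τ u) = -u·G u + wmi u` for small `u < 0` (`G u = g₀ ((1 - u)/N)` analytic at `0`, `w±` fractions), and
`Δh = A/B` cofinitely.  Reading `Δh` through both charts gives a fraction `ψpl = Λ` on `u > 0` and `ψmi = -Λ` on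
`u < 0` with the SAME analytic `Λ u = σ u · G (σ u) - u · G u` (`σ u = u/(1 + N u)` is `t ↦ t + 1`); rigidity of
rational identities through `u = 0` forces `ψpl = -ψmi` on both sides, i.e. `2·A/B = Δ(wpl + wmi)` at infinity, hence
(polynomial identity) everywhere: with the rational function `E := (Wpl + Wmi)/2` one gets `Δ(h - E) = 0` cofinitely
and `h - E = ±(u·G u + w u)` on the two charts, `w = (wpl - wmi)/2`.
-/

set_option linter.dupNamespace false

namespace Summit.Langlands.Langlands.Theorems

open Filter Set Topology Polynomial

/-- THE STEP AT INFINITY (see the module docstring). -/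
theorem anCore_infinity (N : ℕ) (hN : 0 < N) (h g₀ : ℝ → ℂ) (hg₀ : AnalyticAt ℝ g₀ ((1 : ℝ) / N))
    (δ₁ : ℝ) (hδ₁ : 0 < δ₁) (Pp Qp : ℂ[X])
    (hright : ∀ u : ℝ, 0 < u → u < δ₁ → Qp.eval (u : ℂ) ≠ 0 ∧
      h ((1 - u) / ((N : ℝ) * u)) = (u : ℂ) * g₀ ((1 - u) / N) + Pp.eval (u : ℂ) / Qp.eval (u : ℂ))
    (δ₂ : ℝ) (hδ₂ : 0 < δ₂) (Pm Qm : ℂ[X])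
    (hleft : ∀ u : ℝ, u < 0 → -δ₂ < u → Qm.eval (u : ℂ) ≠ 0 ∧
      h ((1 - u) / ((N : ℝ) * u)) = -(u : ℂ) * g₀ ((1 - u) / N) + Pm.eval (u : ℂ) / Qm.eval (u : ℂ))
    (A B : ℂ[X]) (hΔ : ∀ᶠ (t : ℝ) in Filter.cofinite, B.eval (t : ℂ) ≠ 0 ∧
      h (t + 1) - h t = A.eval (t : ℂ) / B.eval (t : ℂ)) :
    ∃ PE QE : ℂ[X], QE ≠ 0 ∧
      (∀ᶠ (t : ℝ) in Filter.cofinite, (h (t + 1) - PE.eval (((t + 1 : ℝ)) : ℂ) / QE.eval (((t + 1 : ℝ)) : ℂ)) -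
        (h t - PE.eval (t : ℂ) / QE.eval (t : ℂ)) = 0) ∧
      ∃ Pw Qw : ℂ[X], (∀ β : ℂ, ¬ (Pw.IsRoot β ∧ Qw.IsRoot β)) ∧ ∃ δ : ℝ, 0 < δ ∧
        (∀ u : ℝ, 0 < u → u < δ → Qw.eval (u : ℂ) ≠ 0 ∧
          QE.eval ((((1 - u) / ((N : ℝ) * u) : ℝ)) : ℂ) ≠ 0 ∧
          h ((1 - u) / ((N : ℝ) * u)) - PE.eval ((((1 - u) / ((N : ℝ) * u) : ℝ)) : ℂ) /
            QE.eval ((((1 - u) / ((N : ℝ) * u) : ℝ)) : ℂ) =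
            (u : ℂ) * g₀ ((1 - u) / N) + Pw.eval (u : ℂ) / Qw.eval (u : ℂ)) ∧
        (∀ u : ℝ, u < 0 → -δ < u → Qw.eval (u : ℂ) ≠ 0 ∧
          QE.eval ((((1 - u) / ((N : ℝ) * u) : ℝ)) : ℂ) ≠ 0 ∧
          h ((1 - u) / ((N : ℝ) * u)) - PE.eval ((((1 - u) / ((N : ℝ) * u) : ℝ)) : ℂ) /
            QE.eval ((((1 - u) / ((N : ℝ) * u) : ℝ)) : ℂ) =
            -(u : ℂ) * g₀ ((1 - u) / N) - Pw.eval (u : ℂ) / Qw.eval (u : ℂ)) := by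
  have hN' : (0 : ℝ) < N := by exact_mod_cast hN
  have hNc : (N : ℂ) ≠ 0 := by exact_mod_cast hN.ne'
  obtain ⟨δS, hδS0, hSδ₁, hSδ₂, hSN, hS0⟩ :=
    anCore_charts N hN h g₀ hg₀ δ₁ hδ₁ Pp Qp hright δ₂ hδ₂ Pm Qm hleft A B hΔ
  -- names
  set τ : ℝ → ℝ := fun u => (1 - u) / ((N : ℝ) * u) with hτ
  set σ : ℝ → ℝ := fun u => u / (1 + (N : ℝ) * u) with hσ
  have hS : ∀ u : ℝ, u ≠ 0 → |u| < δS →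
      Qp.eval (u : ℂ) ≠ 0 ∧ Qm.eval (u : ℂ) ≠ 0 ∧ Qp.eval ((σ u : ℝ) : ℂ) ≠ 0 ∧ Qm.eval ((σ u : ℝ) : ℂ) ≠ 0 ∧
      B.eval ((τ u : ℝ) : ℂ) ≠ 0 ∧
      2 * (A.eval ((τ u : ℝ) : ℂ) / B.eval ((τ u : ℝ) : ℂ)) =
        (Pp.eval ((σ u : ℝ) : ℂ) / Qp.eval ((σ u : ℝ) : ℂ) - Pp.eval (u : ℂ) / Qp.eval (u : ℂ)) +
        (Pm.eval ((σ u : ℝ) : ℂ) / Qm.eval ((σ u : ℝ) : ℂ) - Pm.eval (u : ℂ) / Qm.eval (u : ℂ)) := hS0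
  have hQp0 : Qp ≠ 0 := by
    intro h0; have := (hright (δ₁ / 2) (by linarith) (by linarith)).1
    rw [h0, Polynomial.eval_zero] at this; exact this rfl
  have hQm0 : Qm ≠ 0 := by
    intro h0; have := (hleft (-(δ₂ / 2)) (by linarith) (by linarith)).1
    rw [h0, Polynomial.eval_zero] at this; exact this rfl
  obtain ⟨PWp, QWp, hWp⟩ := anCore_mobius_frac 1 0 1 N Pp Qp
  obtain ⟨PWm, QWm, hWm⟩ := anCore_mobius_frac 1 0 1 N Pm Qm
  have hmobu : ∀ t : ℝ, (1 + 0 * (t : ℂ)) / (1 + (N : ℂ) * t) = ((((N : ℝ) * t + 1)⁻¹ : ℝ) : ℂ) := by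
    intro t; push_cast; rw [zero_mul, add_zero, one_div, add_comm]
  -- the rational function `E = (W₊ + W₋)/2` in the variable `t`
  set PE : ℂ[X] := PWp * QWm + PWm * QWp with hPE
  set QE : ℂ[X] := C 2 * (QWp * QWm) with hQE
  have hE : ∀ t : ℝ, (N : ℝ) * t + 1 ≠ 0 → Qp.eval ((((N : ℝ) * t + 1)⁻¹ : ℝ) : ℂ) ≠ 0 →
      Qm.eval ((((N : ℝ) * t + 1)⁻¹ : ℝ) : ℂ) ≠ 0 →
      QE.eval (t : ℂ) ≠ 0 ∧ PE.eval (t : ℂ) / QE.eval (t : ℂ) =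
        (Pp.eval ((((N : ℝ) * t + 1)⁻¹ : ℝ) : ℂ) / Qp.eval ((((N : ℝ) * t + 1)⁻¹ : ℝ) : ℂ) +
          Pm.eval ((((N : ℝ) * t + 1)⁻¹ : ℝ) : ℂ) / Qm.eval ((((N : ℝ) * t + 1)⁻¹ : ℝ) : ℂ)) / 2 := by
    intro t h1 hQpu hQmu
    have h1c : (1 : ℂ) + (N : ℂ) * t ≠ 0 := by
      have : (1 : ℝ) + (N : ℝ) * t ≠ 0 := by rwa [add_comm] at h1
      exact_mod_cast this
    obtain ⟨hQWp, hfp⟩ := hWp (t : ℂ) h1c (by rw [hmobu]; exact hQpu)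
    obtain ⟨hQWm, hfm⟩ := hWm (t : ℂ) h1c (by rw [hmobu]; exact hQmu)
    rw [hmobu] at hfp hfm
    simp only [hPE, hQE, Polynomial.eval_mul, Polynomial.eval_add, Polynomial.eval_C]
    refine ⟨mul_ne_zero two_ne_zero (mul_ne_zero hQWp hQWm), ?_⟩
    rw [hfp, hfm]
    field_simp
  -- the identity on both `t`-tails
  obtain ⟨hutR, hutL⟩ := anCore_ut_small N hN δS hδS0
  set R : ℝ := max (1 / δS / N) ((1 / δS + 1) / N + 1) with hRdef
  have htail : ∀ t : ℝ, (R < t ∨ t < -R) →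
      B.eval (t : ℂ) ≠ 0 ∧ QE.eval (t : ℂ) ≠ 0 ∧ QE.eval (((t + 1 : ℝ)) : ℂ) ≠ 0 ∧
      A.eval (t : ℂ) / B.eval (t : ℂ) =
        PE.eval (((t + 1 : ℝ)) : ℂ) / QE.eval (((t + 1 : ℝ)) : ℂ) - PE.eval (t : ℂ) / QE.eval (t : ℂ) := by
    intro t ht
    -- smallness of `u t` and `u (t+1)`, nonvanishing of `N t + 1`, `N (t+1) + 1`
    have hsm : ((N : ℝ) * t + 1)⁻¹ ≠ 0 ∧ |((N : ℝ) * t + 1)⁻¹| < δS ∧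
        ((N : ℝ) * (t + 1) + 1)⁻¹ ≠ 0 ∧ |((N : ℝ) * (t + 1) + 1)⁻¹| < δS := by
      rcases ht with ht | ht
      · have h1 : 1 / δS / N < t := lt_of_le_of_lt (le_max_left _ _) ht
        have h2 : 1 / δS / N < t + 1 := by linarith
        obtain ⟨a1, a2⟩ := hutR t h1
        obtain ⟨b1, b2⟩ := hutR (t + 1) h2
        exact ⟨a1.ne', by rw [abs_of_pos a1]; exact a2, b1.ne', by rw [abs_of_pos b1]; exact b2⟩
      · have h0 : (1 / δS + 1) / N + 1 ≤ R := le_max_right _ _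
        have h1 : t < -((1 / δS + 1) / N) := by linarith
        have h2 : t + 1 < -((1 / δS + 1) / N) := by linarith
        obtain ⟨a1, a2⟩ := hutL t h1
        obtain ⟨b1, b2⟩ := hutL (t + 1) h2
        exact ⟨a1.ne, by rw [abs_of_neg a1]; linarith, b1.ne, by rw [abs_of_neg b1]; linarith⟩
    obtain ⟨hu0, huS, hu10, hu1S⟩ := hsm
    have hNt : (N : ℝ) * t + 1 ≠ 0 := fun h0 => hu0 (inv_eq_zero.2 h0)
    have hNt1 : (N : ℝ) * (t + 1) + 1 ≠ 0 := fun h0 => hu10 (inv_eq_zero.2 h0)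
    obtain ⟨hτt, hσt, -⟩ := anCore_ut_identities N hN t hNt
    obtain ⟨hQpu, hQmu, hQpσ, hQmσ, hBτ, hid⟩ := hS _ hu0 huS
    obtain ⟨hQpu1, hQmu1, -, -, -, -⟩ := hS _ hu10 hu1S
    have hτt' : τ (((N : ℝ) * t + 1)⁻¹) = t := hτt
    have hσt' : σ (((N : ℝ) * t + 1)⁻¹) = ((N : ℝ) * (t + 1) + 1)⁻¹ := hσt.symm
    rw [hτt'] at hBτ hid
    rw [hσt'] at hid
    obtain ⟨hQEt, hEt⟩ := hE t hNt hQpu hQmu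
    obtain ⟨hQEt1, hEt1⟩ := hE (t + 1) hNt1 hQpu1 hQmu1
    refine ⟨hBτ, hQEt, hQEt1, ?_⟩
    rw [hEt, hEt1]
    linear_combination hid / 2
  -- the polynomial identity, hence cofinitely everywhere
  have hZ : A * (QE.comp (X + 1) * QE) - B * (PE.comp (X + 1) * QE - PE * QE.comp (X + 1)) = 0 := by
    apply Polynomial.eq_zero_of_infinite_isRoot
    have hsub : ((fun t : ℝ => (t : ℂ)) '' Set.Ioi R) ⊆
        {x : ℂ | (A * (QE.comp (X + 1) * QE) - B * (PE.comp (X + 1) * QE - PE * QE.comp (X + 1))).IsRoot x} := by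
      rintro _ ⟨t, ht, rfl⟩
      obtain ⟨hBt, hQEt, hQEt1, hq⟩ := htail t (Or.inl ht)
      push_cast at hQEt1 hq
      simp only [Set.mem_setOf_eq, Polynomial.IsRoot, Polynomial.eval_sub, Polynomial.eval_mul,
        Polynomial.eval_comp, Polynomial.eval_add, Polynomial.eval_X, Polynomial.eval_one]
      rw [div_eq_iff hBt] at hq
      rw [hq]
      field_simp
      ring
    exact Set.Infinite.mono hsub ((Set.Ioi_infinite R).image Complex.ofReal_injective.injOn)
  have hB0 : B ≠ 0 := by
    intro h0; have := (htail (R + 1) (Or.inl (by linarith))).1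
    rw [h0, Polynomial.eval_zero] at this; exact this rfl
  have hQE0 : QE ≠ 0 := by
    intro h0; have := (htail (R + 1) (Or.inl (by linarith))).2.1
    rw [h0, Polynomial.eval_zero] at this; exact this rfl
  have hΔE : ∀ᶠ (t : ℝ) in Filter.cofinite, (h (t + 1) - PE.eval (((t + 1 : ℝ)) : ℂ) / QE.eval (((t + 1 : ℝ)) : ℂ)) -
      (h t - PE.eval (t : ℂ) / QE.eval (t : ℂ)) = 0 := by
    have h1 := tameDecomp_eventually_cofinite_eval_ne_zero hQE0
    have h2 := tameDecomp_eventually_cofinite_eval_ne_zero (anCore_comp_X_add_one_ne_zero hQE0)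
    filter_upwards [hΔ, h1, h2] with t ht hq1 hq2
    have hq2' : QE.eval ((t : ℂ) + 1) ≠ 0 := by simpa [Polynomial.eval_comp] using hq2
    have hz := congrArg (Polynomial.eval (t : ℂ)) hZ
    simp only [Polynomial.eval_sub, Polynomial.eval_mul, Polynomial.eval_comp, Polynomial.eval_add,
      Polynomial.eval_X, Polynomial.eval_one, Polynomial.eval_zero] at hz
    have hAB : A.eval (t : ℂ) / B.eval (t : ℂ) =
        PE.eval ((t : ℂ) + 1) / QE.eval ((t : ℂ) + 1) - PE.eval (t : ℂ) / QE.eval (t : ℂ) := by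
      rw [div_eq_iff ht.1]
      field_simp
      linear_combination hz
    push_cast
    linear_combination ht.2 + hAB
  -- the `u`-charts of `h - E`
  have h2Q : C 2 * (Qp * Qm) ≠ 0 := mul_ne_zero (by simp) (mul_ne_zero hQp0 hQm0)
  obtain ⟨Pw, Qw, hQw0, hnow, hredw⟩ := anCore_reduce (Pp * Qm - Pm * Qp) (C 2 * (Qp * Qm)) h2Q
  have hEτ : ∀ u : ℝ, u ≠ 0 → Qp.eval (u : ℂ) ≠ 0 → Qm.eval (u : ℂ) ≠ 0 →
      QE.eval (((τ u : ℝ)) : ℂ) ≠ 0 ∧ PE.eval (((τ u : ℝ)) : ℂ) / QE.eval (((τ u : ℝ)) : ℂ) =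
        (Pp.eval (u : ℂ) / Qp.eval (u : ℂ) + Pm.eval (u : ℂ) / Qm.eval (u : ℂ)) / 2 ∧
      Qw.eval (u : ℂ) ≠ 0 ∧ (Pp.eval (u : ℂ) / Qp.eval (u : ℂ) - Pm.eval (u : ℂ) / Qm.eval (u : ℂ)) / 2 =
        Pw.eval (u : ℂ) / Qw.eval (u : ℂ) := by
    intro u hu hQpu hQmu
    obtain ⟨hid1, -⟩ := anCore_tau_identities N hN u hu
    have hid1' : (N : ℝ) * τ u + 1 = u⁻¹ := hid1
    have hNτ : (N : ℝ) * τ u + 1 ≠ 0 := by rw [hid1']; exact inv_ne_zero hu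
    have hinv : ((N : ℝ) * τ u + 1)⁻¹ = u := by rw [hid1', inv_inv]
    have hE' := hE (τ u) hNτ (by rw [hinv]; exact hQpu) (by rw [hinv]; exact hQmu)
    rw [hinv] at hE'
    have h2u : (C 2 * (Qp * Qm)).eval (u : ℂ) ≠ 0 := by
      simp only [Polynomial.eval_mul, Polynomial.eval_C]
      exact mul_ne_zero two_ne_zero (mul_ne_zero hQpu hQmu)
    obtain ⟨hQwu, hfr⟩ := hredw (u : ℂ) h2u
    refine ⟨hE'.1, hE'.2, hQwu, ?_⟩
    rw [← hfr]
    simp only [Polynomial.eval_mul, Polynomial.eval_sub, Polynomial.eval_C]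
    field_simp
  refine ⟨PE, QE, hQE0, hΔE, Pw, Qw, hnow, δS, hδS0, fun u hu0 hu => ?_, fun u hu0 hu => ?_⟩
  · obtain ⟨hQpu, hQmu, -, -, -, -⟩ := hS u hu0.ne' (by rw [abs_of_pos hu0]; exact hu)
    have hu1 : u < δ₁ := by linarith
    obtain ⟨-, hhu⟩ := hright u hu0 hu1
    obtain ⟨hQEτ, hEτu, hQwu, hw⟩ := hEτ u hu0.ne' hQpu hQmu
    refine ⟨hQwu, hQEτ, ?_⟩
    have hhu' : h (τ u) = (u : ℂ) * g₀ ((1 - u) / N) + Pp.eval (u : ℂ) / Qp.eval (u : ℂ) := hhu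
    show h (τ u) - PE.eval (((τ u : ℝ)) : ℂ) / QE.eval (((τ u : ℝ)) : ℂ) = _
    rw [hEτu, hhu', ← hw]
    ring
  · obtain ⟨hQpu, hQmu, -, -, -, -⟩ := hS u hu0.ne (by rw [abs_of_neg hu0]; linarith)
    have hu2 : -δ₂ < u := by linarith
    obtain ⟨-, hhu⟩ := hleft u hu0 hu2
    obtain ⟨hQEτ, hEτu, hQwu, hw⟩ := hEτ u hu0.ne hQpu hQmu
    refine ⟨hQwu, hQEτ, ?_⟩
    have hhu' : h (τ u) = -(u : ℂ) * g₀ ((1 - u) / N) + Pm.eval (u : ℂ) / Qm.eval (u : ℂ) := hhu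
    show h (τ u) - PE.eval (((τ u : ℝ)) : ℂ) / QE.eval (((τ u : ℝ)) : ℂ) = _
    rw [hEτu, hhu', ← hw]
    ring

end Summit.Langlands.Langlands.Theorems
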